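import Summits.Ventures.Crystal3D.StickySpheres.ContactGraph
import Summits.Ventures.Crystal3D.LocalLP.Certificate
import Literature.Geometry.DiscreteGeometry.KissingNumberThreeProofs
import HarnessLib

/-!
# The contact bridge: local inequalities per coordination type + an exact LP certificate ⇒ a
# bound on the contact number of a unit sphere packing in `ℝ³`

HONEST FRAMING. Part of the venture `Summits/Ventures/Crystal3D` (cell `pub-crystal3d`). This file
PROVES (no `sorry`, no named-fact hypotheses):

* `coordination_le_twelve` — in a packing of unit-diameter balls in `ℝ³` every ball touches at
  most `12` others. This is the kissing-number theorem, imported from the tree where it is proved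
  (`Literature.Geometry.DiscreteGeometry.musin2006_kissing_three_holds`, Schütte–van der Waerden
  1953 / Musin 2006), applied to the unit vectors `x j - x i` of the contact neighbours.
* `numContacts_le_six_mul`, `maxContacts_three_le` — hence `C(x) ≤ 6N` for every packing and
  `C(N) ≤ 6N` (the leading term of Bezdek's `C(N) < 6N - 0.926 N^{2/3}`; the surface correction
  is NOT proved here).
* `coordType` — the LOCAL TYPE of a ball = its coordination number `0, …, 12` (a `Fin 13`), the
  type alphabet of the cell's first LP; `sum_typeCount_coordType_mul` — the objective identity
  `∑ τ, (#balls of type τ) · τ = 2 · C(x)`.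
* `two_mul_numContacts_le_of_cert` — THE BRIDGE: for a unit packing `x`, any VALID integer LP
  certificate (`LocalLP/Certificate.lean`) over the 13 type counts with objective `τ ↦ τ`, any
  non-negative parameters `p` (e.g. `(N, S)`), and a proof that the type counts of `x` satisfy the
  rows (this is where per-type local inequalities and global resource bounds enter, aggregated by
  `LocalLP.sum_le_sum_typeCount_mul`), yield `2 · C(x) ≤ ∑ k, D k · p k`.
* `sixNCert`, `sixNCert_valid`, `two_mul_numContacts_le_twelve_mul_of_cert` — the end-to-end
  worked instance: the 14-row certificate {`∑ q ≤ N`; `-q_τ ≤ 0`} with multipliers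
  `(12; 12, 11, …, 0)` is checked by `decide` and reproduces `2 · C(x) ≤ 12 N` through the bridge.

What is NOT here: any surface (`N^{2/3}`) term — that needs the cell's geometric local
inequalities (exposed cap areas per type) and an isoperimetric lower bound, which enter the
bridge as feasibility hypotheses when they are proved or cited.

References: K. Bezdek, S. Reid, *Contact graphs of unit sphere packings revisited*, J. Geom. 104
(2013) 57–83, §2 (the type-LP pattern); O. R. Musin, *The kissing problem in three dimensions*,
Discrete Comput. Geom. 35 (2006) 375–384 (kissing number twelve, proved in the tree).
-/

noncomputable section

open scoped BigOperators
open Finset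

namespace Summit.Ventures.Crystal3D

open Literature.Geometry.DiscreteGeometry (musin2006_kissing_three_holds)
open LocalLP

variable {N : ℕ} {x : Fin N → EuclideanSpace ℝ (Fin 3)}

/-! ## Kissing: at most twelve contacts per ball -/

/-- **At most twelve contacts per ball.** In a packing of unit-diameter balls in `ℝ³` every ball
has coordination number `≤ 12`: the contact neighbours `j` of `i` give unit vectors `x j - x i`
pairwise at distance `dist (x j) (x k) ≥ 1`, and the tree's kissing-number theorem
(`musin2006_kissing_three_holds`) bounds their number by `12`. -/
theorem coordination_le_twelve (hx : IsUnitPacking x) (i : Fin N) : coordination x i ≤ 12 := by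
  classical
  have hinj : Set.InjOn (fun j => x j - x i) ↑(contactNeighbors x i) :=
    fun j _ k _ h => hx.injective (sub_left_injective h)
  rw [coordination, ← card_image_of_injOn hinj]
  refine musin2006_kissing_three_holds _ ?_ ?_
  · intro v hv
    obtain ⟨j, hj, rfl⟩ := mem_image.1 hv
    rw [← dist_eq_norm, dist_comm]
    exact ((mem_contactNeighbors x).1 hj).2
  · intro v hv w hw hvw
    obtain ⟨j, hj, rfl⟩ := mem_image.1 hv
    obtain ⟨k, hk, rfl⟩ := mem_image.1 hw
    have hjk : j ≠ k := fun h => hvw (by rw [h])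
    rw [dist_eq_norm, sub_sub_sub_cancel_right, ← dist_eq_norm]
    exact hx hjk

/-- Handshake + kissing: `2 · C(x) ≤ 12 N`. -/
theorem two_mul_numContacts_le (hx : IsUnitPacking x) : 2 * numContacts x ≤ 12 * N := by
  rw [← sum_coordination_eq]
  calc ∑ i, coordination x i ≤ ∑ _i : Fin N, 12 :=
        sum_le_sum fun i _ => coordination_le_twelve hx i
    _ = 12 * N := by simp [mul_comm]

/-- **`C(x) ≤ 6N`**: a packing of `N` unit-diameter balls in `ℝ³` has at most `6N` contacts. -/
theorem numContacts_le_six_mul (hx : IsUnitPacking x) : numContacts x ≤ 6 * N := by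
  have := two_mul_numContacts_le hx
  omega

/-- **`C(N) ≤ 6N`** for the maximal contact number of `N` unit-diameter balls in `ℝ³` (the
leading term of Bezdek's bound; the `N^{2/3}` correction is not claimed here). -/
theorem maxContacts_three_le (N : ℕ) : maxContacts 3 N ≤ 6 * N :=
  maxContacts_le (by norm_num) fun _ hx => numContacts_le_six_mul hx

/-! ## Local types = coordination numbers, and the objective identity -/

/-- The **local type** of ball `i`: its coordination number, truncated to `Fin 13` (no truncation
happens in a packing, `coordType_val`). -/
def coordType (x : Fin N → EuclideanSpace ℝ (Fin 3)) (i : Fin N) : Fin 13 :=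
  ⟨min (coordination x i) 12, by omega⟩

/-- In a packing the type of a ball is literally its coordination number. -/
theorem coordType_val (hx : IsUnitPacking x) (i : Fin N) :
    ((coordType x i : Fin 13) : ℕ) = coordination x i := by
  simp [coordType, min_eq_left (coordination_le_twelve hx i)]

/-- The type counts of a packing sum to `N`. -/
theorem sum_typeCount_coordType (x : Fin N → EuclideanSpace ℝ (Fin 3)) :
    ∑ τ, typeCount (coordType x) τ = N :=
  sum_typeCount _

/-- **Objective identity**: `∑ τ, (#balls of type τ) · τ = 2 · C(x)` (handshake, by type). -/
theorem sum_typeCount_coordType_mul (hx : IsUnitPacking x) :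
    ∑ τ : Fin 13, (typeCount (coordType x) τ : ℝ) * ((τ : ℕ) : ℝ) = 2 * (numContacts x : ℝ) := by
  rw [← sum_comp_eq_sum_typeCount_mul (coordType x) (fun τ : Fin 13 => ((τ : ℕ) : ℝ))]
  simp_rw [coordType_val hx]
  exact_mod_cast sum_coordination_eq x

/-! ## The bridge -/

/-- **LP-certificate → contact bound.** Let `x` be a packing of `N` unit-diameter balls in `ℝ³`,
`P` a VALID integer LP certificate over the 13 coordination-type counts whose objective is the
coordination number (`c τ = τ`), and `p ≥ 0` parameters. If the type counts of `x` satisfy every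
row of `P` at `p` — each row being an aggregated local inequality or a global resource bound —
then `2 · C(x) ≤ ∑ k, D k · p k`. -/
theorem two_mul_numContacts_le_of_cert (hx : IsUnitPacking x) {m r : ℕ} (P : LPCert m 13 r)
    (hP : P.Valid) (hc : ∀ τ : Fin 13, P.c τ = (τ : ℕ)) {p : Fin r → ℝ} (hp : ∀ k, 0 ≤ p k)
    (hfeas : P.Feasible (fun τ => (typeCount (coordType x) τ : ℝ)) p) :
    2 * (numContacts x : ℝ) ≤ ∑ k, (P.D k : ℝ) * p k := by
  rw [← sum_typeCount_coordType_mul hx]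
  calc ∑ τ : Fin 13, (typeCount (coordType x) τ : ℝ) * ((τ : ℕ) : ℝ)
      = ∑ τ, (P.c τ : ℝ) * (typeCount (coordType x) τ : ℝ) := by
        refine sum_congr rfl fun τ _ => ?_
        rw [hc τ]; push_cast; ring
    _ ≤ ∑ k, (P.D k : ℝ) * p k := P.sound hP hp hfeas

/-- The same bridge for sign-aware certificates (`ValidGE`, using that counts are `≥ 0`). -/
theorem two_mul_numContacts_le_of_certGE (hx : IsUnitPacking x) {m r : ℕ} (P : LPCert m 13 r)
    (hP : P.ValidGE) (hc : ∀ τ : Fin 13, P.c τ = (τ : ℕ)) {p : Fin r → ℝ} (hp : ∀ k, 0 ≤ p k)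
    (hfeas : P.Feasible (fun τ => (typeCount (coordType x) τ : ℝ)) p) :
    2 * (numContacts x : ℝ) ≤ ∑ k, (P.D k : ℝ) * p k := by
  rw [← sum_typeCount_coordType_mul hx]
  calc ∑ τ : Fin 13, (typeCount (coordType x) τ : ℝ) * ((τ : ℕ) : ℝ)
      = ∑ τ, (P.c τ : ℝ) * (typeCount (coordType x) τ : ℝ) := by
        refine sum_congr rfl fun τ _ => ?_
        rw [hc τ]; push_cast; ring
    _ ≤ ∑ k, (P.D k : ℝ) * p k :=
        P.sound_of_nonneg hP (fun _ => Nat.cast_nonneg _) hp hfeas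

/-! ## Worked instance: the `6N` bound through a `decide`-checked certificate -/

/-- The certificate of `2 · C ≤ 12 N`: variables `q τ` (`τ = 0..12`), one parameter `p₀ = N`;
row `0`: `∑ τ, q τ ≤ p₀`; row `τ + 1`: `-q τ ≤ 0`; objective `c τ = τ`; bound `12 p₀`;
multipliers `y 0 = 12`, `y (τ+1) = 12 - τ`; scale `1`. -/
def sixNCert : LPCert 14 13 1 where
  A := Fin.cons (fun _ => 1) fun τ' τ => if τ = τ' then -1 else 0
  B := Fin.cons (fun _ => 1) fun _ _ => 0
  c := fun τ => (τ : ℕ)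
  D := fun _ => 12
  y := Fin.cons 12 fun τ' => 12 - (τ' : ℕ)
  scale := 1

/-- The `6N` certificate is valid — checked by `decide` (integer arithmetic in the kernel). -/
theorem sixNCert_valid : sixNCert.Valid := by
  unfold sixNCert LPCert.Valid
  decide

/-- The type counts of ANY configuration satisfy the rows of `sixNCert` at `p₀ = N`
(row `0` is `∑ counts = N`, the others are `counts ≥ 0`). -/
theorem sixNCert_feasible (x : Fin N → EuclideanSpace ℝ (Fin 3)) :
    sixNCert.Feasible (fun τ => (typeCount (coordType x) τ : ℝ)) (fun _ => (N : ℝ)) := by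
  intro i
  refine Fin.cases ?_ (fun τ' => ?_) i
  · -- row 0 : ∑ τ, 1 * count τ ≤ 1 * N
    have h := sum_typeCount_coordType x
    simp only [sixNCert, Fin.cons_zero, Int.cast_one, one_mul, univ_unique, sum_const,
      card_singleton, one_smul]
    exact_mod_cast h.le
  · -- row τ'+1 : -count τ' ≤ 0
    simp only [sixNCert, Fin.cons_succ, Int.cast_ite, Int.cast_neg, Int.cast_one, Int.cast_zero,
      ite_mul, neg_mul, one_mul, zero_mul, sum_ite_eq', mem_univ, if_true, sum_const_zero]
    exact neg_nonpos.2 (Nat.cast_nonneg _)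

/-- **End-to-end check of the pipeline**: the `decide`-checked certificate `sixNCert` fed through
the bridge gives `2 · C(x) ≤ 12 N` for every unit packing in `ℝ³` (the same inequality as
`two_mul_numContacts_le`, obtained the LP way). -/
theorem two_mul_numContacts_le_twelve_mul_of_cert (hx : IsUnitPacking x) :
    2 * (numContacts x : ℝ) ≤ 12 * N := by
  have h := two_mul_numContacts_le_of_cert hx sixNCert sixNCert_valid (fun _ => rfl)
    (p := fun _ => (N : ℝ)) (fun _ => Nat.cast_nonneg _) (sixNCert_feasible x)
  simpa [sixNCert] using h

end Summit.Ventures.Crystal3D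

end
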